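import Literature.Analysis.FluidPDE.LeiZhang2017SmallSwirlContinuation
import Literature.Analysis.FluidPDE.AxisymOmegaThetaGronwall
import Literature.Analysis.FluidPDE.AxisymSmallSwirlL4
import HarnessLib

/-!
# Lei–Zhang 2017, Thm. 1.4 (first alternative): the discharge
# `LeiZhang2017_smallSwirl_regularity_holds`

Analysis/FluidPDE proof file (theorems only; no definitions, no named facts): the proof of the
named fact `Literature.Analysis.FluidPDE.LeiZhang2017_smallSwirl_regularity`
(`LeiZhang2017AxisymmetricCriteria`; Lei–Zhang, Pacific J. Math. 289 (2017), Thm. 1.4, first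
alternative, arXiv:1505.02628 §4 p. 10).

The continuation theorem `LeiZhang2017_smallSwirl_regularity_of_L4_apriori`
(`LeiZhang2017SmallSwirlContinuation`) reduces the fact to a uniform `L⁴` a-priori bound of
axisymmetric Tao-class solutions from data with `‖Γ₀‖_{L^∞} ≤ δ M₀⁻¹`.  The bound is assembled
here from the tree's chain of files formalising Lei–Zhang's §4 in the smooth Hou–Li variables
`Φ = u^θ/r`, `Ω = ω^θ/r`:

1. `‖Γ(t)‖_{L²} ≤ ‖Γ₀‖_{L²}`, `|Γ(t)| ≤ ‖Γ₀‖_∞` (`AxisymSwirlL2Bound`, `SwirlMaximumPrinciple`);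
2. the fixed-time inequality `d/dt (‖V²‖² + ‖Ω‖²) ≤ 0` under
   `C_A (‖Ω‖² M² ‖Γ‖²)^{1/4} ≤ 1/3` ((7-1)–(7-3); `AxisymSmallSwirlSlice`) and the continuity
   argument (`AxisymSmallSwirlBootstrap`): `E(t) ≤ E₀`, `∫₀ᵀ‖∇Ω‖² ≤ 2E₀`;
3. the `ω^θ` bound by Grönwall (`AxisymOmegaThetaEnergy`, `AxisymOmegaThetaGronwall`);
4. the `L⁴` bound from `∫r²Φ⁴`, `∫r²Ω²`, `‖Γ‖_∞` (`AxisymSmallSwirlL4`).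

The absolute constant is `δ = 1 / (13 (C_A² + 1))`, `C_A = √N + Λ C_S` the constant of
`HouLeiLiSupBound` (Lemma 2.1): then `‖Γ₀‖_∞ M₀ ≤ δ` gives `M²‖Γ₀‖²₂E₀ ≤ δ²`
(`E₀ = ‖V₀²‖² + ‖Ω₀‖² ≤ (‖Ω₀‖ + ‖V₀²‖)²`), whence `C_A⁴ L M² ‖Γ₀‖²₂ ≤ 1/81` for
`L = 2E₀ + η`, `η > 0` small, which is the smallness required by the bootstrap.

* `LeiZhang2017_smallSwirl_L4_apriori` — the `L⁴` a-priori bound;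
* `LeiZhang2017_smallSwirl_regularity_holds : LeiZhang2017_smallSwirl_regularity`.

## Mathlib / tree search

Tree: `LeiZhang2017_smallSwirl_regularity_of_L4_apriori`, `IsTaoSolutionOn.smallSwirl_energy_le`,
`IsTaoSolutionOn.omegaTheta_sq_le`, `IsTaoSolutionOn.eLpNorm_four_le_of_bounds`,
`IsTaoSolutionOn.abs_swirl_le`, `IsAxisymmetric.cylRadius_sq_mul_angVortQuot / angVelQuot`,
`swirl_eq_cylRadius_mul_swirlVelocity`, `volume_axis_eq_zero`, `lintegral_enorm_sq_eq_eLpNorm_two_sq`.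

## References

* Z. Lei, Q. S. Zhang, Criticality of the axially symmetric Navier–Stokes equations, Pacific J.
  Math. 289 (2017) 169–187, arXiv:1505.02628, Thm. 1.4 and §4 (p. 10). [`LeiZhang2017`]
* T. Y. Hou, Z. Lei, C. Li, Comm. PDE 33 (2008), 1622–1637. [folklore]
-/

noncomputable section

open MeasureTheory Set Function Filter Topology InnerProductSpace WithLp
open scoped RealInnerProductSpace Laplacian ContDiff ENNReal NNReal

namespace Literature.Analysis.FluidPDE

/-! ### Helpers -/

section Helpers

/-- `abs` bound from an `L^∞` bound for a continuous real function. [folklore] -/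
private theorem abs_le_toReal_eLpNorm_top_aux {g : EuclideanSpace ℝ (Fin 3) → ℝ} (hg : Continuous g)
    (hfin : eLpNorm g ⊤ volume < ⊤) (x : EuclideanSpace ℝ (Fin 3)) : |g x| ≤ (eLpNorm g ⊤ volume).toReal := by
  -- pointwise `L^∞` bound: `Literature.Analysis.FunctionSpaces.enorm_le_eLpNorm_top_of_continuous`
  -- (SobolevDomainProofs; the former private copy `…_aux` was retired, dedup-01035)
  have h := Literature.Analysis.FunctionSpaces.enorm_le_eLpNorm_top_of_continuous volume hg x
  rw [← ofReal_norm, Real.norm_eq_abs] at h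
  exact (ENNReal.ofReal_le_iff_le_toReal hfin.ne).1 h

/-- `∫ g² = (‖g‖_{L²}.toReal)²` for a continuous real `g ∈ L²`. [folklore] -/
private theorem integral_sq_eq_toReal_eLpNorm_sq_aux {g : EuclideanSpace ℝ (Fin 3) → ℝ} (hg : Continuous g) :
    ∫ x, g x ^ 2 = ((eLpNorm g 2 volume).toReal) ^ 2 := by
  rw [integral_eq_lintegral_of_nonneg_ae (ae_of_all _ fun x => sq_nonneg _) (hg.pow 2).aestronglyMeasurable]
  have : ∫⁻ x, ENNReal.ofReal (g x ^ 2) = ∫⁻ x, ‖g x‖ₑ ^ 2 := lintegral_congr fun x => by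
    rw [← ofReal_norm, Real.norm_eq_abs, ← ENNReal.ofReal_pow (abs_nonneg _), sq_abs]
  rw [this, lintegral_enorm_sq_eq_eLpNorm_two_sq, ENNReal.toReal_pow]

/-- `C_A √√X ≤ 1/3` from `C_A⁴ X ≤ 1/81`. [folklore] -/
private theorem mul_sqrt_sqrt_le_third_aux {C X : ℝ} (hX : 0 ≤ X) (h : C ^ 4 * X ≤ 1 / 81) :
    C * Real.sqrt (Real.sqrt X) ≤ 1 / 3 := by
  set s := Real.sqrt (Real.sqrt X) with hs
  have hs4 : s ^ 4 = X := by
    rw [show (4 : ℕ) = 2 * 2 from rfl, pow_mul, Real.sq_sqrt (Real.sqrt_nonneg _), Real.sq_sqrt hX]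
  refine le_of_pow_le_pow_left₀ (n := 4) (by norm_num) (by norm_num) ?_
  rw [mul_pow, hs4]
  norm_num
  exact h

end Helpers

/-! ### The data: `Γ₀`, `Ω₀ = bigOmega`, `V₀² = vSq`, and the smallness constant -/

section Data

variable {u₀ : EuclideanSpace ℝ (Fin 3) → EuclideanSpace ℝ (Fin 3)}

/-- Off the axis `bigOmega u₀ = Ω₀ = angVortQuot u₀`; the axis is null. [folklore] -/
theorem bigOmega_ae_eq_angVortQuot (hu : ContDiff ℝ 3 u₀) (hax : IsAxisymmetric u₀) :
    LeiZhang2017.bigOmega u₀ =ᵐ[volume] angVortQuot u₀ := by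
  have hax0 : ∀ᵐ x : EuclideanSpace ℝ (Fin 3) ∂volume, x 0 ^ 2 + x 1 ^ 2 ≠ 0 := by
    have := volume_axis_eq_zero
    rw [ae_iff]; simpa using this
  filter_upwards [hax0] with x hx
  have hr : cylRadius x ≠ 0 := by
    intro h0; apply hx; rw [← cylRadius_sq, h0]; ring
  have h1 := hax.cylRadius_sq_mul_angVortQuot hu x
  have h2 := swirl_eq_cylRadius_mul_swirlVelocity (FluidPDE.curl u₀) hr
  simp only [LeiZhang2017.bigOmega]
  rw [h2] at h1
  have h3 : cylRadius x * angVortQuot u₀ x = swirlVelocity (FluidPDE.curl u₀) x :=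
    mul_left_cancel₀ hr (by rw [← h1]; ring)
  rw [div_eq_iff hr, ← h3]; ring

/-- Off the axis `(vSq u₀)² = (x₀² + x₁²) Φ₀⁴` (`Φ₀ = angVelQuot u₀`); the axis is null. [folklore] -/
theorem vSq_sq_ae_eq (hu : ContDiff ℝ 2 u₀) (hax : IsAxisymmetric u₀) :
    (fun x => LeiZhang2017.vSq u₀ x ^ 2) =ᵐ[volume]
      fun x : EuclideanSpace ℝ (Fin 3) => (x 0 ^ 2 + x 1 ^ 2) * angVelQuot u₀ x ^ 4 := by
  have hax0 : ∀ᵐ x : EuclideanSpace ℝ (Fin 3) ∂volume, x 0 ^ 2 + x 1 ^ 2 ≠ 0 := by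
    have := volume_axis_eq_zero
    rw [ae_iff]; simpa using this
  filter_upwards [hax0] with x hx
  have hr : cylRadius x ≠ 0 := by
    intro h0; apply hx; rw [← cylRadius_sq, h0]; ring
  have h1 := hax.cylRadius_sq_mul_angVelQuot hu x
  have h2 := swirl_eq_cylRadius_mul_swirlVelocity u₀ hr
  simp only [LeiZhang2017.vSq]
  rw [h2] at h1
  have hsv : swirlVelocity u₀ x = cylRadius x * angVelQuot u₀ x :=
    mul_left_cancel₀ hr (by rw [← h1]; ring)
  rw [hsv, ← cylRadius_sq]
  field_simp

end Data

/-! ### The `L⁴` a-priori bound and the discharge -/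

section Main

set_option maxHeartbeats 400000 in
/-- **The uniform `L⁴` a-priori bound of Lei–Zhang 2017, Thm. 1.4 (first alternative), in Tao's
class**: with the absolute constant `δ = 1/(13 (C_A² + 1))`, for every `T > 0` and every smooth
divergence-free rapidly decaying `H^∞` axisymmetric datum `u₀` with `Ω₀ = bigOmega u₀ ∈ L²`,
`V₀² = vSq u₀ ∈ L²`, `Γ₀ ∈ L² ∩ L^∞` and `‖Γ₀‖_∞ ≤ δ / M₀`, there is `N ≥ 0` such that every
Tao-class solution on `[0, T'] ⊆ [0, T]` from `u₀` with axisymmetric slices obeys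
`‖u(t)‖_{L⁴} ≤ N` on `[0, T']`. [cite: LeiZhang2017, Thm. 1.4 and §4 (p. 10)] -/
theorem LeiZhang2017_smallSwirl_L4_apriori ⦃T : ℝ⦄ (hT : 0 < T)
    ⦃u₀ : EuclideanSpace ℝ (Fin 3) → EuclideanSpace ℝ (Fin 3)⦄
    (hsm : ContDiff ℝ ∞ u₀) (_hdiv : VectorCalculus.IsDivFree u₀)
    (_hdec : HasRapidSpatialDecay u₀) (_hH : ∀ n : ℕ, ∫⁻ x, ‖iteratedFDeriv ℝ n u₀ x‖ₑ ^ 2 < ⊤)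
    (haxi : IsAxisymmetric u₀)
    (hΩ : eLpNorm (LeiZhang2017.bigOmega u₀) 2 volume < ⊤)
    (hV : eLpNorm (LeiZhang2017.vSq u₀) 2 volume < ⊤)
    (hΓ2 : eLpNorm (swirl u₀) 2 volume < ⊤) (hΓi : eLpNorm (swirl u₀) ∞ volume < ⊤)
    (hsmall : eLpNorm (swirl u₀) ∞ volume ≤
      ENNReal.ofReal (1 / (13 * ((Real.sqrt newtonNearSqInt + newtonFarLaplacianL65 *
        SNormLESNormFDerivOfEqConst ℝ (volume : Measure (EuclideanSpace ℝ (Fin 3))) 2) ^ 2 + 1))) /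
        LeiZhang2017.M0 u₀) :
    ∃ N : ℝ, 0 ≤ N ∧ ∀ ⦃T' : ℝ⦄, 0 < T' → T' ≤ T →
      ∀ ⦃u : ℝ → EuclideanSpace ℝ (Fin 3) → EuclideanSpace ℝ (Fin 3)⦄
        ⦃p : ℝ → EuclideanSpace ℝ (Fin 3) → ℝ⦄,
        IsTaoSolutionOn T' 1 u₀ u p →
        (∀ t ∈ Icc 0 T', IsAxisymmetric (u t)) →
        ∀ t ∈ Icc 0 T', eLpNorm (u t) 4 volume ≤ ENNReal.ofReal N := by
  -- constants (named by equations, not `set`, to keep elaboration light)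
  obtain ⟨CA, hCA⟩ : ∃ CA : ℝ, CA = Real.sqrt newtonNearSqInt + newtonFarLaplacianL65 *
      SNormLESNormFDerivOfEqConst ℝ (volume : Measure (EuclideanSpace ℝ (Fin 3))) 2 := ⟨_, rfl⟩
  have hCA0 : 0 ≤ CA := by rw [hCA]; have := newtonFarLaplacianL65_nonneg; positivity
  obtain ⟨δ, hδ_def⟩ : ∃ δ : ℝ, δ = 1 / (13 * (CA ^ 2 + 1)) := ⟨_, rfl⟩
  have hδ0 : 0 < δ := by rw [hδ_def]; positivity
  rw [← hCA, ← hδ_def] at hsmall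
  -- the data
  have hu3 : ContDiff ℝ 3 u₀ := hsm.of_le (by norm_cast)
  have hu2 : ContDiff ℝ 2 u₀ := hsm.of_le (by norm_cast)
  have cΓ : Continuous (swirl u₀) := (contDiff_swirl hsm).continuous
  have cΦ : Continuous (angVelQuot u₀) := (contDiff_angVelQuot_of_contDiff hsm).continuous
  have cΩ : Continuous (angVortQuot u₀) := (contDiff_angVortQuot_of_contDiff hsm).continuous
  have hρ0 : ∀ x : EuclideanSpace ℝ (Fin 3), 0 ≤ x 0 ^ 2 + x 1 ^ 2 := fun x => by positivity
  -- `M = ‖Γ₀‖_∞`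
  obtain ⟨M, hM_def⟩ : ∃ M : ℝ, M = (eLpNorm (swirl u₀) ∞ volume).toReal := ⟨_, rfl⟩
  have hMx : ∀ x, |swirl u₀ x| ≤ M := fun x => hM_def ▸ abs_le_toReal_eLpNorm_top_aux cΓ hΓi x
  have hM0 : 0 ≤ M := by rw [hM_def]; exact ENNReal.toReal_nonneg
  -- `G₀ = ‖Γ₀‖₂² = C²`
  obtain ⟨C, hC_def⟩ : ∃ C : ℝ, C = (eLpNorm (swirl u₀) 2 volume).toReal := ⟨_, rfl⟩
  have hC0 : 0 ≤ C := by rw [hC_def]; exact ENNReal.toReal_nonneg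
  have hG₀ : ∫ x, swirl u₀ x ^ 2 = C ^ 2 := by rw [hC_def]; exact integral_sq_eq_toReal_eLpNorm_sq_aux cΓ
  have hΓ0fin : ∫⁻ x, ‖swirl u₀ x‖ₑ ^ 2 < ⊤ := by
    rw [lintegral_enorm_sq_eq_eLpNorm_two_sq]; exact ENNReal.pow_lt_top hΓ2
  -- `‖Ω₀‖₂ = AΩ`, `‖V₀²‖₂ = Bv`
  have hΩeq : eLpNorm (LeiZhang2017.bigOmega u₀) 2 volume = eLpNorm (angVortQuot u₀) 2 volume :=
    eLpNorm_congr_ae (bigOmega_ae_eq_angVortQuot hu3 haxi)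
  obtain ⟨AΩ, hAΩ_def⟩ : ∃ A : ℝ, A = (eLpNorm (angVortQuot u₀) 2 volume).toReal := ⟨_, rfl⟩
  have hAΩ0 : 0 ≤ AΩ := by rw [hAΩ_def]; exact ENNReal.toReal_nonneg
  have hB₀ : ∫ x, angVortQuot u₀ x ^ 2 = AΩ ^ 2 := by rw [hAΩ_def]; exact integral_sq_eq_toReal_eLpNorm_sq_aux cΩ
  have hΩ₀fin : eLpNorm (angVortQuot u₀) 2 volume < ⊤ := hΩeq ▸ hΩ
  obtain ⟨Bv, hBv_def⟩ : ∃ B : ℝ, B = (eLpNorm (LeiZhang2017.vSq u₀) 2 volume).toReal := ⟨_, rfl⟩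
  have hBv0 : 0 ≤ Bv := by rw [hBv_def]; exact ENNReal.toReal_nonneg
  have hlinV : ∫⁻ x : EuclideanSpace ℝ (Fin 3), ENNReal.ofReal ((x 0 ^ 2 + x 1 ^ 2) * angVelQuot u₀ x ^ 4) =
      eLpNorm (LeiZhang2017.vSq u₀) 2 volume ^ 2 := by
    rw [← lintegral_enorm_sq_eq_eLpNorm_two_sq]
    refine lintegral_congr_ae ((vSq_sq_ae_eq hu2 haxi).mono fun x hx => ?_)
    simp only at hx ⊢
    rw [← hx, ← ofReal_norm, Real.norm_eq_abs, ← ENNReal.ofReal_pow (abs_nonneg _), sq_abs]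
  have h4nn : ∀ x : EuclideanSpace ℝ (Fin 3), 0 ≤ (x 0 ^ 2 + x 1 ^ 2) * angVelQuot u₀ x ^ 4 := fun x =>
    mul_nonneg (hρ0 x) (by positivity)
  have cA : Continuous fun x : EuclideanSpace ℝ (Fin 3) => (x 0 ^ 2 + x 1 ^ 2) * angVelQuot u₀ x ^ 4 :=
    (contDiff_horizSq (n := 0)).continuous.mul (cΦ.pow 4)
  have hA₀ : ∫ x : EuclideanSpace ℝ (Fin 3), (x 0 ^ 2 + x 1 ^ 2) * angVelQuot u₀ x ^ 4 = Bv ^ 2 := by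
    rw [integral_eq_lintegral_of_nonneg_ae (ae_of_all _ h4nn) cA.aestronglyMeasurable, hlinV,
      ENNReal.toReal_pow, hBv_def]
  -- integrability of the two energy densities of the datum
  have iA₀ : Integrable (fun x : EuclideanSpace ℝ (Fin 3) => (x 0 ^ 2 + x 1 ^ 2) * angVelQuot u₀ x ^ 4) volume := by
    refine ⟨cA.aestronglyMeasurable, ?_⟩
    rw [hasFiniteIntegral_iff_ofReal (ae_of_all _ h4nn), hlinV]
    exact ENNReal.pow_lt_top hV
  have mΩ₀ : MemLp (angVortQuot u₀) 2 volume := ⟨cΩ.aestronglyMeasurable, hΩ₀fin⟩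
  have iB₀ : Integrable (fun x => angVortQuot u₀ x ^ 2) volume := mΩ₀.integrable_sq
  obtain ⟨E₀, hE₀_def⟩ : ∃ E : ℝ, E = ∫ x : EuclideanSpace ℝ (Fin 3),
      ((x 0 ^ 2 + x 1 ^ 2) * angVelQuot u₀ x ^ 4 + angVortQuot u₀ x ^ 2) := ⟨_, rfl⟩
  have hE₀ : E₀ = Bv ^ 2 + AΩ ^ 2 := by rw [hE₀_def, integral_add iA₀ iB₀, hA₀, hB₀]
  have hE₀0 : 0 ≤ E₀ := by rw [hE₀]; positivity
  ------------------------------------------------------------------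
  -- the key smallness `M ((AΩ + Bv) C) ≤ δ`
  ------------------------------------------------------------------
  have hP : M * ((AΩ + Bv) * C) ≤ δ := by
    by_cases h0 : LeiZhang2017.M0 u₀ = 0
    · have : (eLpNorm (LeiZhang2017.bigOmega u₀) 2 volume + eLpNorm (LeiZhang2017.vSq u₀) 2 volume) = 0 ∨
          eLpNorm (swirl u₀) 2 volume = 0 := mul_eq_zero.1 h0
      rcases this with hab | hc
      · have ha : eLpNorm (angVortQuot u₀) 2 volume = 0 := by rw [← hΩeq]; exact (add_eq_zero.1 hab).1
        have hb : eLpNorm (LeiZhang2017.vSq u₀) 2 volume = 0 := (add_eq_zero.1 hab).2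
        have hA0 : AΩ = 0 := by rw [hAΩ_def, ha, ENNReal.toReal_zero]
        have hB0 : Bv = 0 := by rw [hBv_def, hb, ENNReal.toReal_zero]
        rw [hA0, hB0]; simp only [add_zero, zero_mul, mul_zero]; exact hδ0.le
      · have hCz : C = 0 := by rw [hC_def, hc, ENNReal.toReal_zero]
        rw [hCz]; simp only [mul_zero]; exact hδ0.le
    · have hfin : LeiZhang2017.M0 u₀ ≠ ⊤ := by
        simp only [LeiZhang2017.M0]
        exact ENNReal.mul_ne_top (ENNReal.add_ne_top.2 ⟨hΩ.ne, hV.ne⟩) hΓ2.ne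
      have h1 : eLpNorm (swirl u₀) ∞ volume * LeiZhang2017.M0 u₀ ≤ ENNReal.ofReal δ :=
        (ENNReal.le_div_iff_mul_le (Or.inl h0) (Or.inl hfin)).1 hsmall
      have h2 : (eLpNorm (swirl u₀) ∞ volume * LeiZhang2017.M0 u₀).toReal = M * ((AΩ + Bv) * C) := by
        simp only [LeiZhang2017.M0]
        rw [ENNReal.toReal_mul, ENNReal.toReal_mul, ENNReal.toReal_add hΩ.ne hV.ne, hΩeq, hM_def, hAΩ_def,
          hBv_def, hC_def]
      rw [← h2]
      exact ENNReal.toReal_le_of_le_ofReal hδ0.le h1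
  have hK1 : M ^ 2 * C ^ 2 * E₀ ≤ δ ^ 2 := by
    have h1 : E₀ ≤ (AΩ + Bv) ^ 2 := by
      have hsq : (AΩ + Bv) ^ 2 = AΩ ^ 2 + 2 * (AΩ * Bv) + Bv ^ 2 := by ring
      have := mul_nonneg hAΩ0 hBv0
      rw [hE₀, hsq]; linarith
    have h2 : 0 ≤ M * ((AΩ + Bv) * C) := by positivity
    calc M ^ 2 * C ^ 2 * E₀ ≤ M ^ 2 * C ^ 2 * (AΩ + Bv) ^ 2 :=
          mul_le_mul_of_nonneg_left h1 (by positivity)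
      _ = (M * ((AΩ + Bv) * C)) ^ 2 := by ring
      _ ≤ δ ^ 2 := pow_le_pow_left₀ h2 hP 2
  ------------------------------------------------------------------
  -- the level `L` and the smallness of the bootstrap
  ------------------------------------------------------------------
  obtain ⟨η, hη⟩ : ∃ η : ℝ, η = (7 / 13689) / (CA ^ 4 * (M ^ 2 * C ^ 2) + 1) := ⟨_, rfl⟩
  have hη0 : 0 < η := by rw [hη]; positivity
  obtain ⟨L, hL_def⟩ : ∃ L : ℝ, L = 2 * E₀ + η := ⟨_, rfl⟩
  have hL : E₀ < L := by rw [hL_def]; linarith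
  have hsmallL : CA * Real.sqrt (Real.sqrt (L * (M ^ 2 * ∫ x, swirl u₀ x ^ 2))) ≤ 1 / 3 := by
    rw [hG₀]
    refine mul_sqrt_sqrt_le_third_aux (mul_nonneg (by linarith) (by positivity)) ?_
    have hδeq : δ * (13 * (CA ^ 2 + 1)) = 1 := by
      rw [hδ_def]; field_simp
    have hδCA : CA ^ 2 * δ ≤ 1 / 13 := by
      have : 13 * (CA ^ 2 * δ) = 1 - 13 * δ := by linear_combination hδeq
      linarith
    have h1 : CA ^ 4 * δ ^ 2 ≤ 1 / 169 := by
      have : CA ^ 4 * δ ^ 2 = (CA ^ 2 * δ) ^ 2 := by ring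
      rw [this]
      have h0 : 0 ≤ CA ^ 2 * δ := by positivity
      calc (CA ^ 2 * δ) ^ 2 ≤ (1 / 13) ^ 2 := pow_le_pow_left₀ h0 hδCA 2
        _ = 1 / 169 := by norm_num
    have hηeq : η * (CA ^ 4 * (M ^ 2 * C ^ 2) + 1) = 7 / 13689 := by
      rw [hη]; field_simp
    have hQ0 : 0 ≤ CA ^ 4 * (M ^ 2 * C ^ 2) := by positivity
    have h2 : CA ^ 4 * (M ^ 2 * C ^ 2) * η ≤ 7 / 13689 := by
      have : CA ^ 4 * (M ^ 2 * C ^ 2) * η = 7 / 13689 - η := by linear_combination hηeq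
      linarith
    calc CA ^ 4 * (L * (M ^ 2 * C ^ 2)) = 2 * (CA ^ 4 * (M ^ 2 * C ^ 2 * E₀)) + CA ^ 4 * (M ^ 2 * C ^ 2) * η := by
          rw [hL_def]; ring
      _ ≤ 2 * (CA ^ 4 * δ ^ 2) + 7 / 13689 := by
          have := mul_le_mul_of_nonneg_left hK1 (show 0 ≤ CA ^ 4 by positivity)
          linarith
      _ ≤ 2 * (1 / 169) + 7 / 13689 := by linarith
      _ = 1 / 81 := by norm_num
  ------------------------------------------------------------------
  -- the bound `N`
  ------------------------------------------------------------------
  obtain ⟨Y₀, hY₀⟩ : ∃ Y : ℝ, Y = ∫ x : EuclideanSpace ℝ (Fin 3), (x 0 ^ 2 + x 1 ^ 2) * angVortQuot u₀ x ^ 2 := ⟨_, rfl⟩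
  have hY₀0 : 0 ≤ Y₀ := by rw [hY₀]; exact integral_nonneg fun x => mul_nonneg (hρ0 x) (sq_nonneg _)
  have hKE0 : 0 ≤ VectorCalculus.kineticEnergy u₀ := kineticEnergy_nonneg u₀
  have hK0 : 0 ≤ (SNormLESNormFDerivOfEqConst (EuclideanSpace ℝ (Fin 3))
      (volume : Measure (EuclideanSpace ℝ (Fin 3))) 2 : ℝ) := NNReal.coe_nonneg _
  obtain ⟨Ybd, hYbd⟩ : ∃ Yb : ℝ, Yb = (Y₀ + E₀ * T) * Real.exp (2 * CA * (T + 2 * E₀ ^ 2)) := ⟨_, rfl⟩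
  have hYbd0 : 0 ≤ Ybd := by rw [hYbd]; positivity
  obtain ⟨N₁, hN₁⟩ : ∃ N : ℝ, N = (E₀ + M ^ 2 * (2 * VectorCalculus.kineticEnergy u₀)) ^ (1 / 4 : ℝ) := ⟨_, rfl⟩
  obtain ⟨N₂, hN₂⟩ : ∃ N : ℝ, N = (Real.sqrt (4 * (2 * VectorCalculus.kineticEnergy u₀)) *
      ((SNormLESNormFDerivOfEqConst (EuclideanSpace ℝ (Fin 3))
        (volume : Measure (EuclideanSpace ℝ (Fin 3))) 2 : ℝ) * Real.sqrt Ybd) ^ 3) ^ (1 / 4 : ℝ) := ⟨_, rfl⟩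
  have hN₁0 : 0 ≤ N₁ := by rw [hN₁]; exact Real.rpow_nonneg (by positivity) _
  have hN₂0 : 0 ≤ N₂ := by rw [hN₂]; exact Real.rpow_nonneg (by positivity) _
  refine ⟨N₁ + N₂, add_nonneg hN₁0 hN₂0, ?_⟩
  intro T' hT' hT'T u p h haxiu t ht
  -- the a-priori bounds for this solution
  have hMt : ∀ x, |swirl (u t) x| ≤ M := h.abs_swirl_le one_pos hT' haxiu hMx t ht
  have hL' := hL
  rw [hE₀_def] at hL'
  rw [hCA] at hsmallL
  obtain ⟨hEle, -⟩ := h.smallSwirl_energy_le hT' haxiu hMx hΓ0fin hL' hsmallL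
  have hYt := h.omegaTheta_sq_le hT' haxiu hMx hΓ0fin hL' hsmallL t ht
  rw [← hE₀_def, ← hY₀, ← hCA] at hYt
  -- `A(t) ≤ E(t) ≤ E₀`
  have hcl := h.classical
  have hut : ContDiff ℝ ∞ (u t) := hcl.contDiff_velocity ht
  have hHt : ∀ n : ℕ, ∫⁻ x, ‖iteratedFDeriv ℝ n (u t) x‖ₑ ^ 2 < ⊤ := fun n => by
    obtain ⟨C', hC'⟩ := h.sobolev n; exact (hC' t ht).trans_lt ENNReal.coe_lt_top
  have mΩ : MemLp (angVortQuot (u t)) 2 volume := memLp_of_sobolev (contDiff_angVortQuot_of_contDiff hut)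
    ((haxiu t ht).lintegral_sq_iteratedFDeriv_angVortQuot_lt_top hut hHt)
  have mΦ : MemLp (angVelQuot (u t)) 2 volume := memLp_of_sobolev (contDiff_angVelQuot_of_contDiff hut)
    ((haxiu t ht).lintegral_sq_iteratedFDeriv_angVelQuot_lt_top hut hHt)
  obtain ⟨B, -, hB⟩ := h.exists_bound_velocity
  have hB₂ : ∀ x : EuclideanSpace ℝ (Fin 3), (x 0 ^ 2 + x 1 ^ 2) * angVelQuot (u t) x ^ 2 ≤ B ^ 2 := fun x =>
    ((haxiu t ht).horizSq_mul_angVelQuot_sq_le (hut.of_le (by norm_cast)) x).trans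
      (pow_le_pow_left₀ (norm_nonneg _) (hB t ht x) 2)
  have cP : Continuous fun x : EuclideanSpace ℝ (Fin 3) => (x 0 ^ 2 + x 1 ^ 2) * angVelQuot (u t) x ^ 2 :=
    (contDiff_horizSq (n := 0)).continuous.mul ((contDiff_angVelQuot_of_contDiff hut).continuous.pow 2)
  have iA : Integrable (fun x : EuclideanSpace ℝ (Fin 3) => (x 0 ^ 2 + x 1 ^ 2) * angVelQuot (u t) x ^ 4) volume :=
    (mΦ.integrable_sq.bdd_mul cP.aestronglyMeasurable (ae_of_all _ fun x => by
      rw [Real.norm_of_nonneg (mul_nonneg (hρ0 x) (sq_nonneg _))]; exact hB₂ x)).congr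
      (ae_of_all _ fun x => by simp only; ring)
  have hEt := hEle t ht
  rw [integral_add iA mΩ.integrable_sq, ← hE₀_def] at hEt
  have hAt : ∫ x : EuclideanSpace ℝ (Fin 3), (x 0 ^ 2 + x 1 ^ 2) * angVelQuot (u t) x ^ 4 ≤ E₀ := by
    have : 0 ≤ ∫ x, angVortQuot (u t) x ^ 2 := integral_nonneg fun x => sq_nonneg _
    linarith
  -- `Y(t) ≤ Ybd`
  have hYt' : ∫ x : EuclideanSpace ℝ (Fin 3), (x 0 ^ 2 + x 1 ^ 2) * angVortQuot (u t) x ^ 2 ≤ Ybd := by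
    refine hYt.trans ?_
    rw [hYbd]
    have h1 : Y₀ + E₀ * T' ≤ Y₀ + E₀ * T := by
      have := mul_le_mul_of_nonneg_left hT'T hE₀0; linarith
    have h2 : Real.exp (2 * CA * (T' + 2 * E₀ ^ 2)) ≤ Real.exp (2 * CA * (T + 2 * E₀ ^ 2)) :=
      Real.exp_le_exp.2 (mul_le_mul_of_nonneg_left (by linarith) (mul_nonneg zero_le_two hCA0))
    exact mul_le_mul h1 h2 (Real.exp_pos _).le (by positivity)
  -- the `L⁴` bound
  have h4 := h.eLpNorm_four_le_of_bounds hT' zero_le_one haxiu ht hMt hAt hYt'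
  rw [ENNReal.ofReal_add hN₁0 hN₂0, hN₁, hN₂]
  exact h4

/-- **Lei–Zhang 2017, Thm. 1.4 (first alternative)** — the discharge of the named fact
`LeiZhang2017_smallSwirl_regularity`: there is an absolute `δ > 0` such that a classical
axisymmetric Navier–Stokes solution (`ν = 1`) in Tao's class on `[0, T)` from a Schwartz-decaying
datum with `Ω₀ ∈ L²`, `V₀² ∈ L²`, `Γ₀ ∈ L² ∩ L^∞` and `‖Γ₀‖_{L^∞} ≤ δ M₀⁻¹` extends smoothly past
`T`. [cite: LeiZhang2017, Thm. 1.4 (first alternative), proof §4 (p. 10)] -/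
theorem LeiZhang2017_smallSwirl_regularity_holds : LeiZhang2017_smallSwirl_regularity :=
  LeiZhang2017_smallSwirl_regularity_of_L4_apriori
    (δ := 1 / (13 * ((Real.sqrt newtonNearSqInt + newtonFarLaplacianL65 *
      SNormLESNormFDerivOfEqConst ℝ (volume : Measure (EuclideanSpace ℝ (Fin 3))) 2) ^ 2 + 1)))
    (by positivity) LeiZhang2017_smallSwirl_L4_apriori

end Main

end Literature.Analysis.FluidPDE

end
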